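import Summits.KontsevichZagierPeriods.Zeta5Search.Zudilin2002CasoratianRates
import Summits.KontsevichZagierPeriods.Zeta5Search.SymRayZudilinBridge
import Summits.KontsevichZagierPeriods.Zeta5Search.Certificates.OrderThree
import Summits.KontsevichZagierPeriods.Zeta5Search.Certificates.RowOfRecurrence
import Literature.NumberTheory.Irrationality.Zudilin2002.ZetaFiveRecursion
import HarnessLib

/-!
# ζ(5) search — calibration of the order-3 wrapper: Zudilin 2002 as `OrderThreeRates (zetaValue 5)` (cell `pub-zeta5`, certifier `cert-1`)

HONEST FRAMING: systematic search; no irrationality claim unless certified.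

`Certificates/OrderThree.lean` filled with data that are ALREADY theorems of the tree (typer g4 chain +
P1's symmetric-ray discharge), field by field — the reference instance a new order-3 candidate copies:

| field | value | tree source |
|---|---|---|
| `u, v` | Zudilin's `qₙ, pₙ` (`ℓₙ = qₙζ(5) − pₙ`) | `Literature…Zudilin2002.q/p` |
| `U`, box | `(−1)^{n+1}qₙ > 0`, `796·Uₙ ≤ Uₙ₊₁` (`n ≥ 2`) | `Zudilin2002Growth.u`, `ratio_bounds` |
| `a b c → A B C` | sign-flipped recursion, `→ 2368, 752, −16` | `u_rec`, `tendsto_A/B/C` |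
| `λ` | `−μ₃ = 2368.3175…` (root in the printed bracket) | `Zudilin2002.charPoly_roots`, `neg_root_of_charPoly` |
| `W`, box | `Zₙ = (−1)ⁿ(qₙpₙ₊₁ − qₙ₊₁pₙ) > 0`, `195·Zₙ ≤ Zₙ₊₁ ≤ 1045·Zₙ` (`n ≥ 3`) | `Z`, `Z_ratio_bounds_sharp`, `abs_casoratian_eq_Z` |
| `aW bW cW → 752, 37888, −256`, `ν = 799.39…` | exterior-square recursion | `Z_rec`, `tendsto_aZ/bZ/cZ`, `casChar_root` |
| `vₙ/uₙ → ζ(5)` | Theorem 1's limit, PROVED on the symmetric ray | `SymRay.theorem1_limits` |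

Outcome: `zudilinRates : OrderThreeRates (zetaValue 5)`, hence by the generic theorems of `OrderThree.lean`
`log|qₙ|/n → log λ`, `log Zₙ/n → log ν`, `log|qₙζ(5) − pₙ|/n → log ν − log λ` (= `log μ₂ = −1.086…`, cf.
`Zudilin2002Decay`: `ν = −μ₂μ₃`), and `zudilinRates.toRateCertificate : RateCertificate (zetaValue 5)`
(growth `log λ = log 2368.32 = 7.7699…`, decay `log λ − log ν = 1.0861…`; this is the `C(2n,n)`-gauge of
`SymmetricRow.symmetricRates`: both rates shift by `log 4`). Scalar checks (`norm_num`): contractions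
`752/796² + 32/796³ < 1`, `37888/195² + 512/195³ < 1`, tail squeeze `1045/796² < 1/2`, `ν < λ`.

ARITHMETIC TIER (CONDITIONAL, clearly labelled): granted the CITED integrality `Zudilin2002.integrality`
(`4Dₙ²qₙ, 4Dₙ⁷pₙ ∈ ℤ`, Sect. 2 (14)–(15); Krattenthaler–Rivoal 2007 strength, not proved in the tree),
`zudilinRow h : RowCertificate (zetaValue 5)` with effective denominators `4·lcm(1..n)⁷` (`δ = 7`): certified brackets
`log λ ∈ (7.7699, 7.7700)`, `log ν ∈ (6.6838, 6.6839)`, **margin `= log λ − log ν − 7 ∈ (−5.9141, −5.9137)`**,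
**worthiness `γ ∈ (0.599, 0.600)`** (exact `0.59960…`; gauge-invariant: the same as Brown–Zudilin's `(Qₙ, Pₙ)` with
denominators `4·C(2n,n)·Dₙ⁷`). The census's PROVED dual-side ladder for this row (`λ_proved = 8.90` in the BZ gauge,
NEAR-MISSES census-g9) and the MODEL `δ = 5` (`SymmetricRow.symmetricRates.worthinessAt 5 ∈ (0.7779, 0.7780)`) are
different statements; nothing here bears on the irrationality of `ζ(5)`. No named fact is USED unconditionally.
-/

noncomputable section

open Filter Topology Set
open Literature.NumberTheory.Irrationality.Zudilin2002
open Literature.NumberTheory.Transcendental (zetaValue)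
open Summit.KontsevichZagierPeriods.Zeta5Search.Zudilin2002Growth

namespace Summit.KontsevichZagierPeriods.Zeta5Search.Certificates

namespace Zudilin2002Rates3

/-- `μ₃ = −2368.3175…`, the large negative root of Zudilin's characteristic polynomial (5), chosen from
the tree's `charPoly_roots`. -/
def mu₃ : ℝ := charPoly_roots.2.choose

/-- `μ₃ ∈ (−2368.31752214, −2368.31752213)` and `χ(μ₃) = 0`. -/
theorem mu₃_spec : mu₃ ∈ Ioo (-236831752214 / 10 ^ 8 : ℝ) (-236831752213 / 10 ^ 8) ∧ charPoly mu₃ = 0 :=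
  charPoly_roots.2.choose_spec

/-- `ν = 799.39…`, the dominant root of the Casoratian recursion, chosen from `casChar_root`. -/
def nu : ℝ := casChar_root.choose

/-- `ν ∈ (799.39, 799.40)` and `ν³ = 752ν² + 37888ν − 256`. -/
theorem nu_spec : nu ∈ Ioo (79939 / 100 : ℝ) (79940 / 100) ∧ nu ^ 3 = 752 * nu ^ 2 + 37888 * nu + (-256) :=
  casChar_root.choose_spec

/-- **Zudilin 2002 as order-3 rate data** (every field a tree theorem; thresholds `N = 3`). -/
def zudilinRates : OrderThreeRates (zetaValue 5) where
  u := q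
  v := p
  N := 3
  U := u
  absU n hn := abs_q_eq_u n (by omega)
  a := A
  b := B
  c := C
  recU n _ := u_rec n
  A := 2368
  B := 752
  C := -16
  tendsto_a := tendsto_A
  tendsto_b := tendsto_B
  tendsto_c := tendsto_C
  L := 796
  L_pos := by norm_num
  boxU n hn := ⟨(ratio_bounds n (by omega)).1, (ratio_bounds n (by omega)).2.1⟩
  lam := -mu₃
  charU := neg_root_of_charPoly mu₃_spec.2
  L_le := by have h := mu₃_spec.1.2; linarith
  contrU := by
    rw [show |(752 : ℝ)| = 752 by norm_num, show |(-16 : ℝ)| = 16 by norm_num]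
    norm_num
  W := Z
  absW n hn := abs_casoratian_eq_Z n (by omega)
  aW := aZ
  bW := bZ
  cW := cZ
  recW n _ := Z_rec n
  AW := 752
  BW := 37888
  CW := -256
  tendsto_aW := tendsto_aZ
  tendsto_bW := tendsto_bZ
  tendsto_cW := tendsto_cZ
  LW := 195
  LamW := 1045
  LW_pos := by norm_num
  boxW n hn := Z_ratio_bounds_sharp n hn
  nu := nu
  charW := nu_spec.2
  LW_le := by have h := nu_spec.1.1; linarith
  contrW := by
    rw [show |(37888 : ℝ)| = 37888 by norm_num, show |(-256 : ℝ)| = 256 by norm_num]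
    norm_num
  theta_lt := by norm_num
  nu_lt := by
    have h1 := nu_spec.1.2
    have h2 := mu₃_spec.1.2
    linarith
  tendsto_div := SymRay.theorem1_limits.1

/-- **Exact growth of Zudilin's denominators through the wrapper**: `log|qₙ|/n → log(−μ₃) = log 2368.3175…`. -/
theorem tendsto_log_abs_q_div :
    Tendsto (fun n : ℕ => Real.log |(q n : ℝ)| / n) atTop (𝓝 (Real.log (-mu₃))) :=
  zudilinRates.tendsto_log_abs_u_div

/-- **Exact Casoratian rate through the wrapper**: `log Zₙ/n → log ν`. -/
theorem tendsto_log_Z_div : Tendsto (fun n : ℕ => Real.log (Z n) / n) atTop (𝓝 (Real.log nu)) :=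
  zudilinRates.tendsto_log_W_div

/-- **Exact decay of Zudilin's ζ(5)-forms through the wrapper**: `log|qₙζ(5) − pₙ|/n → log ν − log(−μ₃)`
(`= log μ₂ = −1.0861…`). -/
theorem tendsto_log_abs_form_div :
    Tendsto (fun n : ℕ => Real.log |(q n : ℝ) * zetaValue 5 - p n| / n) atTop
      (𝓝 (Real.log nu - Real.log (-mu₃))) :=
  zudilinRates.tendsto_log_abs_form_div

/-- The rate certificate of Zudilin's 2002 family (analytic tier): growth `log(−μ₃)`, decay `log(−μ₃) − log ν`. -/
def zudilinRateCertificate : RateCertificate (zetaValue 5) := zudilinRates.toRateCertificate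

/-- Its growth rate is `log(−μ₃)`. -/
theorem zudilinRateCertificate_growthRate : zudilinRateCertificate.growthRate = Real.log (-mu₃) := rfl

/-- Its decay rate is `log(−μ₃) − log ν`. -/
theorem zudilinRateCertificate_decayRate :
    zudilinRateCertificate.decayRate = Real.log (-mu₃) - Real.log nu := rfl


/-! ### Certified logarithm brackets for `λ = −μ₃` and `ν` -/

/-- `7.7699 < log 2368.31752213` (certified: `e^L = (e^(L/8))^8 ≤ (Taylor₁₄ + err)^8 < 2368.3175221300`). -/
theorem log_mu3_lo : (77699 / 10000 : ℝ) < Real.log (236831752213 / 100000000 : ℝ) := by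
  have hx : |(77699 / 80000 : ℝ)| ≤ 1 := by rw [abs_le]; constructor <;> norm_num
  have hb := (abs_sub_le_iff.1 (Real.exp_bound hx (n := 14) (by norm_num))).1
  norm_num [Finset.sum_range_succ, Finset.sum_range_zero, Nat.factorial] at hb
  rw [Real.lt_log_iff_exp_lt (by norm_num), show (77699 / 10000 : ℝ) = ((8:ℕ):ℝ) * (77699 / 80000 : ℝ) by norm_num,
    Real.exp_nat_mul]
  exact lt_of_le_of_lt (pow_le_pow_left₀ (Real.exp_pos _).le hb 8) (by norm_num)

/-- `log 2368.31752214 < 7.7700` (certified: `e^U = (e^(U/8))^8 ≥ (Taylor₁₄ − err)^8 > 2368.3175221400`). -/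
theorem log_mu3_hi : Real.log (236831752214 / 100000000 : ℝ) < (77700 / 10000 : ℝ) := by
  have hx : |(777 / 800 : ℝ)| ≤ 1 := by rw [abs_le]; constructor <;> norm_num
  have hb := (abs_sub_le_iff.1 (Real.exp_bound hx (n := 14) (by norm_num))).2
  norm_num [Finset.sum_range_succ, Finset.sum_range_zero, Nat.factorial] at hb
  have h1 := sub_le_iff_le_add'.mpr hb
  rw [Real.log_lt_iff_lt_exp (by norm_num), show (77700 / 10000 : ℝ) = ((8:ℕ):ℝ) * (777 / 800 : ℝ) by norm_num,
    Real.exp_nat_mul]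
  exact lt_of_lt_of_le (by norm_num) (pow_le_pow_left₀ (by norm_num) h1 8)

/-- `6.6838 < log 799.39` (certified: `e^L = (e^(L/8))^8 ≤ (Taylor₁₄ + err)^8 < 799.3900000000`). -/
theorem log_nu_lo : (66838 / 10000 : ℝ) < Real.log (79939 / 100 : ℝ) := by
  have hx : |(33419 / 40000 : ℝ)| ≤ 1 := by rw [abs_le]; constructor <;> norm_num
  have hb := (abs_sub_le_iff.1 (Real.exp_bound hx (n := 14) (by norm_num))).1
  norm_num [Finset.sum_range_succ, Finset.sum_range_zero, Nat.factorial] at hb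
  rw [Real.lt_log_iff_exp_lt (by norm_num), show (66838 / 10000 : ℝ) = ((8:ℕ):ℝ) * (33419 / 40000 : ℝ) by norm_num,
    Real.exp_nat_mul]
  exact lt_of_le_of_lt (pow_le_pow_left₀ (Real.exp_pos _).le hb 8) (by norm_num)

/-- `log 799.40 < 6.6839` (certified: `e^U = (e^(U/8))^8 ≥ (Taylor₁₄ − err)^8 > 799.4000000000`). -/
theorem log_nu_hi : Real.log (79940 / 100 : ℝ) < (66839 / 10000 : ℝ) := by
  have hx : |(66839 / 80000 : ℝ)| ≤ 1 := by rw [abs_le]; constructor <;> norm_num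
  have hb := (abs_sub_le_iff.1 (Real.exp_bound hx (n := 14) (by norm_num))).2
  norm_num [Finset.sum_range_succ, Finset.sum_range_zero, Nat.factorial] at hb
  have h1 := sub_le_iff_le_add'.mpr hb
  rw [Real.log_lt_iff_lt_exp (by norm_num), show (66839 / 10000 : ℝ) = ((8:ℕ):ℝ) * (66839 / 80000 : ℝ) by norm_num,
    Real.exp_nat_mul]
  exact lt_of_lt_of_le (by norm_num) (pow_le_pow_left₀ (by norm_num) h1 8)

/-- **`7.7699 < log λ < 7.7700`** (`λ = −μ₃ = 2368.3175…`, `log λ = 7.769935…`). -/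
theorem log_lam_mem : (77699 / 10000 : ℝ) < Real.log (-mu₃) ∧ Real.log (-mu₃) < (77700 / 10000 : ℝ) := by
  obtain ⟨⟨h1, h2⟩, -⟩ := mu₃_spec
  have hlo : (236831752213 / 100000000 : ℝ) < -mu₃ := by linarith
  have hhi : -mu₃ < (236831752214 / 100000000 : ℝ) := by linarith
  have hpos : (0 : ℝ) < 236831752213 / 100000000 := by norm_num
  exact ⟨log_mu3_lo.trans (Real.log_lt_log hpos hlo), (Real.log_lt_log (hpos.trans hlo) hhi).trans log_mu3_hi⟩

/-- **`6.6838 < log ν < 6.6839`** (`ν = 799.39…`, `log ν = 6.68385…`). -/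
theorem log_nu_mem : (66838 / 10000 : ℝ) < Real.log nu ∧ Real.log nu < (66839 / 10000 : ℝ) := by
  obtain ⟨⟨h1, h2⟩, -⟩ := nu_spec
  have hpos : (0 : ℝ) < 79939 / 100 := by norm_num
  exact ⟨log_nu_lo.trans (Real.log_lt_log hpos h1), (Real.log_lt_log (hpos.trans h1) h2).trans log_nu_hi⟩

/-- The decay rate of Zudilin's `ζ(5)`-forms: `log λ − log ν ∈ (1.0860, 1.0862)` (`= −log μ₂ = 1.08608…`). -/
theorem decayRate_mem :
    (10860 / 10000 : ℝ) < zudilinRateCertificate.decayRate ∧ zudilinRateCertificate.decayRate < (10862 / 10000 : ℝ) := by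
  rw [zudilinRateCertificate_decayRate]
  obtain ⟨a1, a2⟩ := log_lam_mem
  obtain ⟨b1, b2⟩ := log_nu_mem
  constructor <;> linarith

/-! ### The arithmetic tier, CONDITIONAL on the cited integrality -/

/-- **Zudilin's 2002 family as a `RowCertificate (zetaValue 5)`, CONDITIONAL on the cited fact
`Zudilin2002.integrality`** (`4Dₙ²qₙ, 4Dₙ⁷pₙ ∈ ℤ`): effective denominators `4·lcm(1..n)⁷`, `δ = 7`;
the analytic tier is the (unconditional) `zudilinRateCertificate`. -/
def zudilinRow (h : integrality) : RowCertificate (zetaValue 5) where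
  toRateCertificate := zudilinRateCertificate
  denom n := 4 * Nat.lcmUpto n ^ 7
  denom_pos n := Nat.mul_pos (by norm_num) (Nat.pow_pos (Nat.lcmUpto_pos n))
  denomRate := 7
  tendsto_denom := by
    have h7 := (tendsto_log_prod_lcmUpto_pow_div ![1] ![7])
    have hc : Tendsto (fun n : ℕ => Real.log 4 / (n : ℝ)) atTop (𝓝 0) :=
      tendsto_const_nhds.div_atTop tendsto_natCast_atTop_atTop
    have hsum := hc.add h7
    simp only [Fin.sum_univ_one, Fin.prod_univ_one, Matrix.cons_val_zero, one_mul, Nat.cast_ofNat, zero_add] at hsum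
    refine (hsum.congr' ?_)
    filter_upwards [eventually_gt_atTop 0] with n hn
    have h0 : (0 : ℝ) < Nat.lcmUpto n := by exact_mod_cast Nat.lcmUpto_pos n
    push_cast
    rw [Real.log_mul (by norm_num) (by positivity), add_div]
  isInt_u := by
    filter_upwards [eventually_ge_atTop 1] with n hn
    obtain ⟨⟨z, hz⟩, -, -⟩ := h n hn
    refine ⟨(Nat.lcmUpto n : ℤ) ^ 5 * z, ?_⟩
    change ((4 * Nat.lcmUpto n ^ 7 : ℕ) : ℚ) * q n = _
    push_cast
    rw [← hz]; ring
  isInt_v := by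
    filter_upwards [eventually_ge_atTop 1] with n hn
    obtain ⟨-, ⟨z, hz⟩, -⟩ := h n hn
    refine ⟨z, ?_⟩
    change ((4 * Nat.lcmUpto n ^ 7 : ℕ) : ℚ) * p n = _
    push_cast
    exact hz

/-- The margin of the conditional row: `μ₁ = log λ − log ν − 7`. -/
theorem zudilinRow_margin (h : integrality) :
    (zudilinRow h).margin = Real.log (-mu₃) - Real.log nu - 7 := rfl

/-- **`−5.9141 < μ₁ < −5.9137`** (exact `−5.91391…`): a NEAR-MISS, even granted the cited integrality. -/
theorem zudilinRow_margin_mem (h : integrality) :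
    (-(59141 / 10000) : ℝ) < (zudilinRow h).margin ∧ (zudilinRow h).margin < (-(59137 / 10000) : ℝ) := by
  rw [zudilinRow_margin]
  obtain ⟨a1, a2⟩ := log_lam_mem
  obtain ⟨b1, b2⟩ := log_nu_mem
  constructor <;> linarith

/-- The worthiness of the conditional row: `γ = 1 + (log λ − log ν − 7)/(log λ + 7)`. -/
theorem zudilinRow_worthiness (h : integrality) :
    (zudilinRow h).worthiness = 1 + (Real.log (-mu₃) - Real.log nu - 7) / (Real.log (-mu₃) + 7) := rfl

/-- **`0.599 < γ < 0.600`** (exact `0.59960…`; gauge-invariant: the same for Brown–Zudilin's `(Qₙ, Pₙ)` with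
denominators `4·C(2n,n)·Dₙ⁷`). -/
theorem zudilinRow_worthiness_mem (h : integrality) :
    (599 / 1000 : ℝ) < (zudilinRow h).worthiness ∧ (zudilinRow h).worthiness < (600 / 1000 : ℝ) := by
  rw [zudilinRow_worthiness]
  obtain ⟨a1, a2⟩ := log_lam_mem
  obtain ⟨b1, b2⟩ := log_nu_mem
  set L := Real.log (-mu₃)
  set V := Real.log nu
  have hQ : 0 < L + 7 := by linarith
  constructor
  · have : (-(401 / 1000) : ℝ) * (L + 7) < L - V - 7 := by nlinarith
    have := (lt_div_iff₀ hQ).2 this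
    linarith
  · have : L - V - 7 < (-(400 / 1000) : ℝ) * (L + 7) := by nlinarith
    have := (div_lt_iff₀ hQ).2 this
    linarith

end Zudilin2002Rates3

end Summit.KontsevichZagierPeriods.Zeta5Search.Certificates
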